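import Summits.QuantumFields.BalabanUV.T4Continuum.Support.CovariantMeanContraction

/-!
# `T4Continuum.CovariantMeanSupply` (cell-tree module `Summits/QuantumFields/BalabanUV/T4Continuum/Support/CovariantMeanSupply.lean`)
# — road P4 of the spine estimate NE1′ («observable-level telescoping + first-order covariant-mean propagation»): the road's
# LEAVES AS SLOTS of one renormalisation step — mass count, split sizes, the propagation ladder with its ONE-BLOCK CONTRACTION —
# and the kernel composition «slots ⇒ `FactorisedCovSupply` ⇒ `UniformCovDefect` ⇒ (with `MidLimits`) `HasContinuumLimit`»
# (cell `pub-balaban`, scoping sub-cell `t4`, ROUND-2 prover seat #4 of BINDER-OWNERS row NE1′, unit `b2b-balaban-t4-ne1p-p4`,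
# generation 1; companion of the typed skeleton `t4/skeletons/NE1p-t4-ne1p-p4.md` v1.1 §1/§3; ADDITIVE — a new leaf importing
# `Support/CovariantMeanContraction` (p207492) only; nothing modified)

HONEST FRAMING.  Finite four-torus, rung (B)+1 only: the `ε → 0` limit of the joint expectations of unit-scale averaged
gauge-invariant Wilson-loop variables on ONE torus of fixed physical size, along a Wilson scheme `D.scheme g₀` of a datum of
Bałaban type `D : T4Continuum.FiniteEpsData F G`.  NOT infinite volume, NOT a mass gap, NOT the Clay problem, NOT summit progress.
HONEST DEPENDENCY: continuum YM on T⁴ ⇐ BetaPertH ∧ nine spine estimates (0/9 proved); BetaPertH ⇐ (D1) ∧ (D4) ∧ CAP+tail;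
G-an2-4 gates asym, D1 and NE2/3/4.  Every analytic input below is a FIELD of a hypothesis structure (`StepSupply`) or a
HYPOTHESIS SHAPE (`SlotSupply`), asserted of NO datum; (B), `BetaPertHyp`, (B^μ) are not mentioned because nothing here consumes
them.  STATEMENTS AND QUANTIFIER BOOKKEEPING ONLY: arithmetic of finite sums over the lane's `TermRep`/`CovSplit` data; every
declaration is [folklore] and sorry-free.

CITATION HEADER (lean-in-tree rule).  No page of T. Bałaban's series (CMP 1983–89) or of any other source was newly read for this
module and no sentence is attributed to print here.  Objects re-used BY NAME with their own certified headers' provenance: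
`T4UniformDefectWiring.TermRep` / `loopPullback`, `T4ExteriorCovariance.CovSplit` / `covSize` / `remSize` / `StepCovBudget`,
`B15.BasicStep.fibreIntegral`, `T4Spectator.rho` (telescoping lineage t4-ne1p-p3), `CovariantMeanContraction.Factors` /
`FactorisedCovSupply` / `hasContinuumLimit_of_factorisedCovSupply_midLimits` (this road, p207492), `T4SummableDefect.MidLimits`,
`Missing.HasContinuumLimit`.  For Bałaban's four-dimensional densities NONE of the slots is printed ([Balaban1989LargeFieldII]
p. 356, sentence carried verbatim by `Missing` §2 / `T4Continuum`, not re-quoted here).  ABSOLUTE RULE honoured: no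
programme-internal statement is a hypothesis-free input.

WHY THIS LEAF (skeleton §1/§3).  `CovariantMeanContraction` proved that the road's FACTORISED per-step budget
(`FactorisedCovSupply`) delivers the telescoping lane's exact missing inequality `UniformCovDefect`.  This leaf opens the budget
into the road's LEAVES, one structure field each, for ONE step `k` at distance `n`: NODE O's term representation and first-order
split (`ρr`, `cs`), the mass-weighted count of new large-field components (`massCount`, leaves L4+L5), the split's sensitivity
budget (`sens`, L2) and second-order remainder (`rem`, L3), and the PROPAGATION LADDER of each first-order pairing — its birth
bound (`birth`, L7), **its ONE-BLOCK CONTRACTION `N (j+1) ≤ κb j · N j` (`contract`, L8 — the road's declared OWN-OPEN piece of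
NE1′: the sup norm of the propagated local adjoint-covariant factor contracts per block of undressed steps)**, the rate bookkeeping
(`rate`) and the final pairing (`final`, L10+L11) — and proves `StepSupply … k n → StepCovBudget D g₀ Cs (𝔣.budget n) k n`, hence
`SlotSupply ⇒ FactorisedCovSupply` and the end-to-end `hasContinuumLimit_of_slotSupply_midLimits`.  So the composition «leaves ⇒
root» of the skeleton is kernel-checked SLOT BY SLOT; a supplier's job per leaf is to INSTANTIATE one field for Bałaban's steps.

WHAT IS NOT PROVED / VALUE.  Nothing analytic: no field of `StepSupply` is instantiated for Bałaban's densities (NODE O has no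
owner; L8 is not in print); `SlotSupply` is asserted of no datum.  Value = leaf-granular bookkeeping of the road in the lane's own
currency; NOT summit progress.
-/

noncomputable section

open MeasureTheory Filter Topology Metric Set
open scoped BigOperators

namespace Summit.QuantumFields.BalabanUV.T4Continuum.CovariantMeanContraction

/-! ## §1 The road's leaves as SLOTS of one step: mass count, split sizes, the propagation ladder ⇒ the factorised supply -/

section Slots

open Literature.MathematicalPhysics.QuantumFieldTheory.Balaban1983to89
open T4Continuum T4ExteriorCovariance T4SummableDefect T4ObservableTelescopeTwoRun T4UniformDefectWiring T4ObservableTelescope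
  T4Spectator B15.BasicStep Missing

variable {F : T4Family} {G : Type*} [GaugeGroup G] [MeasurableSpace G] [HaarData G]
variable [∀ K j : ℕ, DecidableEq (PBond (F.P K) j)]

/-- A nonnegative sequence contracted block by block by nonnegative rates is dominated by its initial value times the product of
the rates (the ladder form of `size_le_of_blockContraction`). [folklore] -/
theorem ladder_le_mul_prod {N κ : ℕ → ℝ} (hκ0 : ∀ j, 0 ≤ κ j) (hstep : ∀ j, N (j + 1) ≤ κ j * N j) :
    ∀ J, N J ≤ N 0 * ∏ j ∈ Finset.range J, κ j := by
  intro J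
  induction J with
  | zero => simp
  | succ J ih =>
    calc N (J + 1) ≤ κ J * N J := hstep J
      _ ≤ κ J * (N 0 * ∏ j ∈ Finset.range J, κ j) := mul_le_mul_of_nonneg_left ih (hκ0 J)
      _ = N 0 * ∏ j ∈ Finset.range (J + 1), κ j := by rw [Finset.prod_range_succ]; ring

/-- DATA + HYPOTHESES — **THE ROAD'S LEAVES AS SLOTS FOR ONE STEP** `k` AT DISTANCE `n` (run `K = k+1+n`, string `Cs`, factors `𝔣`;
skeleton `t4/skeletons/NE1p-t4-ne1p-p4.md` §3; NOT PRINTED, asserted of no datum — a supplier must INSTANTIATE every field for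
Bałaban's realised step, which is exactly the road's open mathematics plus NODE O):
* `ρr`, `cs` — NODE O: the (0.3)-term representation of the realised ℝ-step and, per term, the first-order `CovSplit` of its gap
  for the pulled-back loop product in the exact-displacement form (leaf L2; mean-zero shifts by global covariance, leaf L6);
* `massCount` — leaves L4 + L5: the fibre masses of the terms, weighted by the squared size of their new component, are at most
  count `cnt·Λ₄ⁿ` × large-field weight `w n` × the run's total mass;
* `sens` — leaf L2: the split's total sensitivity `(#κ)·θ` is at most `Csens·θ₁ⁿ·|Λ|` (the iterated averaging's one-bond rate);
* `rem` — leaf L3: the second-order remainder of a term is at most its mass × `C₂·(θ₁ⁿ·|Λ|)²`;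
* `N`, `κb`, `J` with `birth`, `contract`, `rate`, `final` — leaves L7 (birth bound of the local covariant factor's sup norm),
  **L8 (ONE block, ONE functional: `N (j+1) ≤ κb j · N j` — the block contraction, the road's declared OWN-OPEN piece of NE1′)**,
  the rate bookkeeping `d·∏κb ≤ Cprop·ρⁿ`, and L10 + L11 (final pairing: `|∫ m·Ω_i·S_i| ≤ θ·∫m·N_J·Cfin`).
The intended MEANING of `N Z i j` — the sup norm, over the complex chart at the scale reached after `j` blocks, of the
`j`-block conditional mean of the pairing's LOCAL adjoint-covariant factor — is not enforceable at this abstraction (as for every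
shape of the lane); the slots fix the ARITHMETIC ROLE of each leaf and nothing else. [folklore] -/
structure StepSupply (D : FiniteEpsData F G) (g₀ : ℕ → ℝ) (Cs : List (ULoop F)) (𝔣 : Factors) (k n : ℕ) where
  /-- NODE O: the (0.3)-representation of the realised step -/
  ρr : TermRep (D.real.Trho (k + 1 + n) (g₀ (k + 1 + n)) k) (D.real.R (k + 1 + n) (g₀ (k + 1 + n)) k)
  /-- NODE O + L2: the first-order split of every term's gap -/
  cs : ∀ Z, CovSplit (ρr.fib Z) (ρr.piece (ρr.pp Z)) (ρr.piece Z) (loopPullback D Cs k n)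
  /-- L4 + L5: mass-weighted count of the new components' squared sizes -/
  massCount : ∑ Z, (∫ V, ρr.piece Z V ∂fieldMeasure (F.P (k + 1 + n)) (k + 1) G) * ((ρr.fib Z).card : ℝ) ^ 2
      ≤ 𝔣.cnt * 𝔣.Λ₄ ^ n * 𝔣.w n *
        ∫ V, rho D (k + 1 + n) (g₀ (k + 1 + n)) (k + 1 + n) V ∂fieldMeasure (F.P (k + 1 + n)) (k + 1 + n) G
  /-- L2: the split's total sensitivity -/
  sens : ∀ Z, (Fintype.card (cs Z).κ : ℝ) * (cs Z).θ ≤ 𝔣.Csens * 𝔣.θ₁ ^ n * ((ρr.fib Z).card : ℝ)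
  /-- L3: the second-order remainder -/
  rem : ∀ Z, (cs Z).remSize
      ≤ (∫ V, ρr.piece Z V ∂fieldMeasure (F.P (k + 1 + n)) (k + 1) G) * (𝔣.C₂ * (𝔣.θ₁ ^ n) ^ 2 * ((ρr.fib Z).card : ℝ) ^ 2)
  /-- number of propagation blocks between the step and the unit scale -/
  J : ℕ
  /-- the propagation ladder: sup norms of the propagated local covariant factor after `j` blocks -/
  N : ∀ Z, (cs Z).κ → ℕ → ℝ
  /-- the block rates -/
  κb : ℕ → ℝ
  /-- the block rates are nonnegative -/
  κb_nonneg : ∀ j, 0 ≤ κb j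
  /-- L7: birth bound (by the split's shift bound) -/
  birth : ∀ Z i, N Z i 0 ≤ (cs Z).d
  /-- **L8: the block contraction** -/
  contract : ∀ Z i j, N Z i (j + 1) ≤ κb j * N Z i j
  /-- rate bookkeeping: birth size × product of block rates ≤ `Cprop·ρⁿ` -/
  rate : ∀ Z, (cs Z).d * ∏ j ∈ Finset.range J, κb j ≤ 𝔣.Cprop * 𝔣.ρ ^ n
  /-- L10 + L11: the final pairing -/
  final : ∀ Z i, |∫ V, fibreIntegral (ρr.fib Z) (ρr.piece Z) V * ((cs Z).Ω i V * (cs Z).S i V)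
      ∂fieldMeasure (F.P (k + 1 + n)) (k + 1) G|
      ≤ (cs Z).θ * (∫ V, ρr.piece Z V ∂fieldMeasure (F.P (k + 1 + n)) (k + 1) G) * N Z i J * 𝔣.Cfin

namespace StepSupply

variable {D : FiniteEpsData F G} {g₀ : ℕ → ℝ} {Cs : List (ULoop F)} {𝔣 : Factors} {k n : ℕ}
variable (σ : StepSupply D g₀ Cs 𝔣 k n)

/-- The mass of a term is nonnegative. [folklore] -/
theorem mass_nonneg (Z : σ.ρr.ι) : 0 ≤ ∫ V, σ.ρr.piece Z V ∂fieldMeasure (F.P (k + 1 + n)) (k + 1) G :=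
  integral_nonneg (σ.ρr.provisos Z).old_nonneg

/-- Along the ladder: `N_J ≤ d·∏κb ≤ Cprop·ρⁿ`. [folklore] -/
theorem ladder_final_le (Z : σ.ρr.ι) (i : (σ.cs Z).κ) : σ.N Z i σ.J ≤ 𝔣.Cprop * 𝔣.ρ ^ n := by
  have h1 := ladder_le_mul_prod σ.κb_nonneg (fun j => σ.contract Z i j) σ.J
  have hprod : 0 ≤ ∏ j ∈ Finset.range σ.J, σ.κb j := Finset.prod_nonneg fun j _ => σ.κb_nonneg j
  exact h1.trans ((mul_le_mul_of_nonneg_right (σ.birth Z i) hprod).trans (σ.rate Z))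

/-- **ONE TERM'S COVARIANCE SIZE** from the slots: `covSize_Z ≤ ∫m_Z · Csens·θ₁ⁿ·|Λ_Z| · Cprop·ρⁿ · Cfin`. [folklore] -/
theorem covSize_le (Z : σ.ρr.ι) : (σ.cs Z).covSize
    ≤ (∫ V, σ.ρr.piece Z V ∂fieldMeasure (F.P (k + 1 + n)) (k + 1) G) *
      (𝔣.Csens * 𝔣.θ₁ ^ n * ((σ.ρr.fib Z).card : ℝ)) * (𝔣.Cprop * 𝔣.ρ ^ n) * 𝔣.Cfin := by
  have hm := σ.mass_nonneg Z
  have hCf := 𝔣.Cfin_nonneg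
  -- each pairing ≤ θ·∫m·(Cprop ρⁿ)·Cfin (and `0 ≤ θ` as soon as a pairing exists, from `Ω_le`)
  have hi : ∀ i ∈ (Finset.univ : Finset (σ.cs Z).κ),
      |∫ V, fibreIntegral (σ.ρr.fib Z) (σ.ρr.piece Z) V * ((σ.cs Z).Ω i V * (σ.cs Z).S i V)
        ∂fieldMeasure (F.P (k + 1 + n)) (k + 1) G|
      ≤ (σ.cs Z).θ * (∫ V, σ.ρr.piece Z V ∂fieldMeasure (F.P (k + 1 + n)) (k + 1) G) * (𝔣.Cprop * 𝔣.ρ ^ n) * 𝔣.Cfin := by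
    intro i _
    refine (σ.final Z i).trans ?_
    have hθ : 0 ≤ (σ.cs Z).θ := (abs_nonneg _).trans ((σ.cs Z).Ω_le i default)
    have hw : 0 ≤ (σ.cs Z).θ * ∫ V, σ.ρr.piece Z V ∂fieldMeasure (F.P (k + 1 + n)) (k + 1) G := mul_nonneg hθ hm
    exact mul_le_mul_of_nonneg_right (mul_le_mul_of_nonneg_left (σ.ladder_final_le Z i) hw) hCf
  have hsum := Finset.sum_le_sum hi
  rw [Finset.sum_const, Finset.card_univ, nsmul_eq_mul] at hsum
  refine hsum.trans ?_
  have hrest : 0 ≤ (∫ V, σ.ρr.piece Z V ∂fieldMeasure (F.P (k + 1 + n)) (k + 1) G) * (𝔣.Cprop * 𝔣.ρ ^ n) * 𝔣.Cfin :=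
    mul_nonneg (mul_nonneg hm (mul_nonneg 𝔣.Cprop_nonneg (pow_nonneg 𝔣.ρ_nonneg n))) hCf
  calc (Fintype.card (σ.cs Z).κ : ℝ) * ((σ.cs Z).θ * (∫ V, σ.ρr.piece Z V ∂fieldMeasure (F.P (k + 1 + n)) (k + 1) G) *
        (𝔣.Cprop * 𝔣.ρ ^ n) * 𝔣.Cfin)
      = ((Fintype.card (σ.cs Z).κ : ℝ) * (σ.cs Z).θ) *
          ((∫ V, σ.ρr.piece Z V ∂fieldMeasure (F.P (k + 1 + n)) (k + 1) G) * (𝔣.Cprop * 𝔣.ρ ^ n) * 𝔣.Cfin) := by ring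
    _ ≤ (𝔣.Csens * 𝔣.θ₁ ^ n * ((σ.ρr.fib Z).card : ℝ)) *
          ((∫ V, σ.ρr.piece Z V ∂fieldMeasure (F.P (k + 1 + n)) (k + 1) G) * (𝔣.Cprop * 𝔣.ρ ^ n) * 𝔣.Cfin) :=
        mul_le_mul_of_nonneg_right (σ.sens Z) hrest
    _ = _ := by ring

/-- **THE SLOTS CLOSE ONE STEP: `StepSupply ⇒ StepCovBudget D g₀ Cs (𝔣.budget n) k n`** (sum of `covSize_le` and `rem` over the
terms against `massCount`, using `|Λ| ≤ |Λ|²` on ℕ). [folklore] -/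
theorem stepCovBudget (σ : StepSupply D g₀ Cs 𝔣 k n) : StepCovBudget D g₀ Cs (𝔣.budget n) k n := by
  refine ⟨σ.ρr, σ.cs, ?_⟩
  -- abbreviations
  set I : ℝ := ∫ V, rho D (k + 1 + n) (g₀ (k + 1 + n)) (k + 1 + n) V ∂fieldMeasure (F.P (k + 1 + n)) (k + 1 + n) G with hI
  have hA : 0 ≤ 𝔣.Csens * 𝔣.θ₁ ^ n * (𝔣.Cprop * 𝔣.ρ ^ n) * 𝔣.Cfin :=
    mul_nonneg (mul_nonneg (mul_nonneg 𝔣.Csens_nonneg (pow_nonneg 𝔣.θ₁_nonneg n))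
      (mul_nonneg 𝔣.Cprop_nonneg (pow_nonneg 𝔣.ρ_nonneg n))) 𝔣.Cfin_nonneg
  have hB : 0 ≤ 𝔣.C₂ * (𝔣.θ₁ ^ n) ^ 2 := mul_nonneg 𝔣.C₂_nonneg (sq_nonneg _)
  -- per-term bound: covSize + remSize ≤ (A·card + B·card²)·mass ≤ (A + B)·mass·card²
  have hterm : ∀ Z ∈ (Finset.univ : Finset σ.ρr.ι), (σ.cs Z).covSize + (σ.cs Z).remSize
      ≤ (𝔣.Csens * 𝔣.θ₁ ^ n * (𝔣.Cprop * 𝔣.ρ ^ n) * 𝔣.Cfin + 𝔣.C₂ * (𝔣.θ₁ ^ n) ^ 2) *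
        ((∫ V, σ.ρr.piece Z V ∂fieldMeasure (F.P (k + 1 + n)) (k + 1) G) * ((σ.ρr.fib Z).card : ℝ) ^ 2) := by
    intro Z _
    have hm := σ.mass_nonneg Z
    have hc : ((σ.ρr.fib Z).card : ℝ) ≤ ((σ.ρr.fib Z).card : ℝ) ^ 2 := by
      have hnat : (σ.ρr.fib Z).card ≤ (σ.ρr.fib Z).card ^ 2 := by
        rcases Nat.eq_zero_or_pos (σ.ρr.fib Z).card with h0 | hpos
        · simp [h0]
        · calc (σ.ρr.fib Z).card = (σ.ρr.fib Z).card * 1 := (mul_one _).symm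
            _ ≤ (σ.ρr.fib Z).card * (σ.ρr.fib Z).card := Nat.mul_le_mul_left _ hpos
            _ = (σ.ρr.fib Z).card ^ 2 := (sq _).symm
      exact_mod_cast hnat
    have h1 := σ.covSize_le Z
    have h2 := σ.rem Z
    have h1' : (σ.cs Z).covSize ≤ 𝔣.Csens * 𝔣.θ₁ ^ n * (𝔣.Cprop * 𝔣.ρ ^ n) * 𝔣.Cfin *
        ((∫ V, σ.ρr.piece Z V ∂fieldMeasure (F.P (k + 1 + n)) (k + 1) G) * ((σ.ρr.fib Z).card : ℝ) ^ 2) := by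
      refine h1.trans ?_
      have e : (∫ V, σ.ρr.piece Z V ∂fieldMeasure (F.P (k + 1 + n)) (k + 1) G) *
          (𝔣.Csens * 𝔣.θ₁ ^ n * ((σ.ρr.fib Z).card : ℝ)) * (𝔣.Cprop * 𝔣.ρ ^ n) * 𝔣.Cfin
          = 𝔣.Csens * 𝔣.θ₁ ^ n * (𝔣.Cprop * 𝔣.ρ ^ n) * 𝔣.Cfin *
            ((∫ V, σ.ρr.piece Z V ∂fieldMeasure (F.P (k + 1 + n)) (k + 1) G) * ((σ.ρr.fib Z).card : ℝ)) := by ring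
      rw [e]
      exact mul_le_mul_of_nonneg_left (mul_le_mul_of_nonneg_left hc hm) hA
    have h2' : (σ.cs Z).remSize ≤ 𝔣.C₂ * (𝔣.θ₁ ^ n) ^ 2 *
        ((∫ V, σ.ρr.piece Z V ∂fieldMeasure (F.P (k + 1 + n)) (k + 1) G) * ((σ.ρr.fib Z).card : ℝ) ^ 2) := by
      refine h2.trans (le_of_eq ?_); ring
    calc (σ.cs Z).covSize + (σ.cs Z).remSize ≤ _ + _ := add_le_add h1' h2'
      _ = _ := by ring
  refine (Finset.sum_le_sum hterm).trans ?_
  rw [← Finset.mul_sum]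
  have hAB : 0 ≤ 𝔣.Csens * 𝔣.θ₁ ^ n * (𝔣.Cprop * 𝔣.ρ ^ n) * 𝔣.Cfin + 𝔣.C₂ * (𝔣.θ₁ ^ n) ^ 2 := add_nonneg hA hB
  calc (𝔣.Csens * 𝔣.θ₁ ^ n * (𝔣.Cprop * 𝔣.ρ ^ n) * 𝔣.Cfin + 𝔣.C₂ * (𝔣.θ₁ ^ n) ^ 2) *
        ∑ Z, (∫ V, σ.ρr.piece Z V ∂fieldMeasure (F.P (k + 1 + n)) (k + 1) G) * ((σ.ρr.fib Z).card : ℝ) ^ 2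
      ≤ (𝔣.Csens * 𝔣.θ₁ ^ n * (𝔣.Cprop * 𝔣.ρ ^ n) * 𝔣.Cfin + 𝔣.C₂ * (𝔣.θ₁ ^ n) ^ 2) *
        (𝔣.cnt * 𝔣.Λ₄ ^ n * 𝔣.w n * I) := mul_le_mul_of_nonneg_left σ.massCount hAB
    _ = 𝔣.budget n * I := by rw [Factors.budget]; ring

end StepSupply

/-- HYPOTHESIS SHAPE — **THE ROAD'S LEAVES, SLOT BY SLOT, AT EVERY STEP**: per string there are `Factors` such that every step at
every distance admits a `StepSupply` (NODE O + leaves L2–L11).  NOT PRINTED, asserted of no datum. [folklore] -/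
def SlotSupply (D : FiniteEpsData F G) (g₀ : ℕ → ℝ) : Prop :=
  ∀ Cs : List (ULoop F), ∃ 𝔣 : Factors, ∀ k n, Nonempty (StepSupply D g₀ Cs 𝔣 k n)

/-- **`SlotSupply ⇒ FactorisedCovSupply`** (step by step). [folklore] -/
theorem factorisedCovSupply_of_slotSupply (D : FiniteEpsData F G) (g₀ : ℕ → ℝ) (h : SlotSupply D g₀) :
    FactorisedCovSupply D g₀ := by
  intro Cs
  obtain ⟨𝔣, hkn⟩ := h Cs
  exact ⟨𝔣, fun k n => (hkn k n).elim fun σ => σ.stepCovBudget⟩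

/-- **END-TO-END FROM THE SLOTS**: `SlotSupply ∧ MidLimits ⇒ Missing.HasContinuumLimit (D.scheme g₀)` — the road's leaves (as
slots over NODE O's data) plus the undressed two-run input give existence of the `ε → 0` limit of the unit-scale averaged loop
expectations along the scheme.  CONDITIONAL on both shapes; rung (B)+1 on the finite torus only. [folklore] -/
theorem hasContinuumLimit_of_slotSupply_midLimits [RegularGaugeGroup G] (D : FiniteEpsData F G) (hM : D.AvgMeasurable)
    (g₀ : ℕ → ℝ) (h : SlotSupply D g₀) (hL : MidLimits D g₀) : HasContinuumLimit (D.scheme g₀) :=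
  hasContinuumLimit_of_factorisedCovSupply_midLimits D hM g₀ (factorisedCovSupply_of_slotSupply D g₀ h) hL

end Slots

end Summit.QuantumFields.BalabanUV.T4Continuum.CovariantMeanContraction
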